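import Summits.MatrixMultiplication.MatrixMultiplication.Theorems.BoundedExponentThird.Negative.TwoLegBound
import Literature.Combinatorics.Additive.TricoloredSumFreeBound

/-!
# `BoundedExponentThird` (crux stmt-MatrixMultiplication-10596, route ThinBlockAlpha):
# in bounded exponent the witness blocks must grow

Negative-side support file of the crux disprover (cdisprove seat); `sorry`-free.

* `isTricoloredSumFree_of_isSTPP` — one triple per block is a tricolored sum-free set of size `L`;
* `card_blocks_le` — hence `L ≤ 3|H|^{1−δ_ℓ}` in exponent `≤ ℓ` (tree Thm A,
  `Literature.Combinatorics.Additive.exists_tricoloredSumFree_card_le`);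
* `not_BoundedExponentThirdBoundedN` — the strengthening of the crux with blocks of bounded size
  `N ≤ N₀` (uniformly in `η`) is FALSE: `|H| ≤ (3N₀³)^{1/δ}`, `L ≤ |H|`, but the two-leg bound of
  `TwoLegBound.lean` gives `1 + 1/L ≤ N₀^η`.  Finite designs calibrate, never witness.
-/

namespace Summit.MatrixMultiplication.MatrixMultiplication.Theorems.BoundedExponentThird.Negative

open Finset Literature.Computability.AlgebraicComplexity
open Summit.MatrixMultiplication.MatrixMultiplication.Theses.ThinBlockAlpha (BoundedExponentThird)

/-! ## §4  In bounded exponent the blocks must grow (tree Thm A + §1) -/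

section BlocksGrow

/-- An STPP family with chosen elements `a i ∈ A i`, `b i ∈ B i`, `c i ∈ C i` yields a tricolored
sum-free set of size `L` (BCCGNSU 2017 §3.1, the `N = 1` case of Thm 3.3): the triples
`(a i − b i, b i − c i, c i − a i)`. -/
theorem isTricoloredSumFree_of_isSTPP {H : Type*} [AddCommGroup H] {L : ℕ}
    {A B C : Fin L → Finset H} (h : IsSTPP A B C) (a b c : Fin L → H)
    (ha : ∀ i, a i ∈ A i) (hb : ∀ i, b i ∈ B i) (hc : ∀ i, c i ∈ C i) :
    Literature.Combinatorics.Additive.IsTricoloredSumFree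
      (fun i => a i - b i) (fun i => b i - c i) (fun i => c i - a i) := by
  intro i j k
  constructor
  · intro he
    have e : (a i - a k) + (b j - b i) + (c k - c j) = (a i - b i) + (b j - c j) + (c k - a k) := by
      abel
    have key := h i j k (a k) (ha k) (a i) (ha i) (b i) (hb i) (b j) (hb j) (c j) (hc j) (c k)
      (hc k) (by rw [e, he])
    exact ⟨key.1, key.2.1⟩
  · rintro ⟨rfl, rfl⟩
    show (a i - b i) + (b i - c i) + (c i - a i) = 0
    abel

/-- **Few blocks in bounded exponent** (tree Thm A `exists_tricoloredSumFree_card_le` applied to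
the tricolored sum-free set of `isTricoloredSumFree_of_isSTPP`): for every `ℓ` there is `δ > 0`
with `L ≤ 3 |H|^{1−δ}` for every STPP family with nonempty sets in an abelian group of exponent
`≤ ℓ`. -/
theorem card_blocks_le (ℓ : ℕ) : ∃ δ : ℝ, 0 < δ ∧ ∀ (H : Type) [AddCommGroup H] [Fintype H],
    AddMonoid.exponent H ≤ ℓ → ∀ (L : ℕ) (A B C : Fin L → Finset H), IsSTPP A B C →
      (∀ i, (A i).Nonempty) → (∀ i, (B i).Nonempty) → (∀ i, (C i).Nonempty) →
        (L : ℝ) ≤ 3 * (Fintype.card H : ℝ) ^ (1 - δ) := by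
  obtain ⟨δ, hδ, hA⟩ := Literature.Combinatorics.Additive.exists_tricoloredSumFree_card_le.{0, 0} ℓ
  refine ⟨δ, hδ, fun H _ _ hexp L A B C h hAne hBne hCne => ?_⟩
  have := hA H hexp (Fin L) _ _ _ (isTricoloredSumFree_of_isSTPP h (fun i => (hAne i).choose)
    (fun i => (hBne i).choose) (fun i => (hCne i).choose) (fun i => (hAne i).choose_spec)
    (fun i => (hBne i).choose_spec) (fun i => (hCne i).choose_spec))
  simpa using this

/-- NATURAL STRENGTHENING: the crux with blocks of BOUNDED size (`N ≤ N₀` uniformly in `η`). -/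
def BoundedExponentThirdBoundedN : Prop :=
  ∃ ℓ N₀ : ℕ, ∀ η : ℝ, 0 < η → ∃ (H : Type) (_ : AddCommGroup H) (_ : Fintype H) (L N M : ℕ)
    (A B C : Fin L → Finset H), N ≤ N₀ ∧ AddMonoid.exponent H ≤ ℓ ∧ IsSTPP A B C ∧
    (∀ i, (A i).card = N ∧ (B i).card = M ∧ (C i).card = N) ∧ 2 ≤ N ∧
    (N : ℝ) ^ (1 / 3 : ℝ) ≤ M ∧ (Fintype.card H : ℝ) ≤ L * (N : ℝ) ^ (2 + η)

/-- It is a strengthening of the crux. -/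
theorem boundedN_imp : BoundedExponentThirdBoundedN → BoundedExponentThird := by
  rintro ⟨ℓ, N₀, h⟩
  refine ⟨ℓ, fun η hη => ?_⟩
  obtain ⟨H, i1, i2, L, N, M, A, B, C, -, rest⟩ := h η hη
  exact ⟨H, i1, i2, L, N, M, A, B, C, rest⟩

/-- **Refuted strengthening: witness blocks must grow as `η → 0`.**  For fixed `ℓ, N₀`:
Thm A bounds `L ≤ 3|H|^{1−δ}`, the packing gives `|H| ≤ L N₀³`, hence `|H| ≤ K := (3N₀³)^{1/δ}`
and `L ≤ K`; but `two_leg_bound` gives `1 + 1/L ≤ N^η ≤ N₀^η`, false once `N₀^η < 1 + 1/K`.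
Consequence for design hunters: finite searches (fixed block gadgets, any number of copies, any
group of exponent `≤ ℓ`) can calibrate but can never witness the crux; `N ≥ |H|^{c·δ_ℓ}` is forced. -/
theorem not_BoundedExponentThirdBoundedN : ¬ BoundedExponentThirdBoundedN := by
  rintro ⟨ℓ, N₀, h⟩
  by_cases hN₀ : N₀ < 2
  · obtain ⟨H, i1, i2, L, N, M, A, B, C, hNN, -, -, -, hN, -⟩ := h 1 one_pos
    omega
  push Not at hN₀
  obtain ⟨δ, hδ, hblocks⟩ := card_blocks_le ℓ
  have hN₀1 : (1 : ℝ) < N₀ := by exact_mod_cast (by omega : 1 < N₀)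
  have hN₀0 : (0 : ℝ) < N₀ := by linarith
  -- the a-priori bound on |H|
  set K : ℝ := (3 * (N₀ : ℝ) ^ (3 : ℝ)) ^ (1 / δ) with hK
  have h3N : (1 : ℝ) ≤ 3 * (N₀ : ℝ) ^ (3 : ℝ) := by
    have : (1 : ℝ) ≤ (N₀ : ℝ) ^ (3 : ℝ) := Real.one_le_rpow hN₀1.le (by norm_num)
    linarith
  have hK1 : 1 ≤ K := Real.one_le_rpow h3N (by positivity)
  have hK0 : 0 < K := by linarith
  set ε : ℝ := 1 + 1 / K with hε
  have hε1 : 1 < ε := by rw [hε]; simp [hK0]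
  set η₁ : ℝ := Real.logb N₀ ε / 2 with hη₁
  have hη₁0 : 0 < η₁ := by
    have := Real.logb_pos hN₀1 hε1
    rw [hη₁]; linarith
  set η : ℝ := min 1 η₁ with hη
  have hη0 : 0 < η := lt_min one_pos hη₁0
  have hηle1 : η ≤ 1 := min_le_left _ _
  have hηle : η ≤ η₁ := min_le_right _ _
  -- the design at slack η
  obtain ⟨H, i1, i2, L, N, M, A, B, C, hNN, hexp, hS, hc, hN, hM, hH⟩ := h η hη0
  classical
  have hM2 : 2 ≤ M := two_le_middle hN hM
  have hL : 0 < L := blocks_pos hH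
  have hN1 : (1 : ℝ) ≤ N := by exact_mod_cast (by omega : 1 ≤ N)
  have hAne : ∀ i, (A i).Nonempty := fun i => card_pos.1 (by rw [(hc i).1]; omega)
  have hBne : ∀ i, (B i).Nonempty := fun i => card_pos.1 (by rw [(hc i).2.1]; omega)
  have hCne : ∀ i, (C i).Nonempty := fun i => card_pos.1 (by rw [(hc i).2.2]; omega)
  have hcard0 : (0 : ℝ) < Fintype.card H := by exact_mod_cast Fintype.card_pos
  -- (i) few blocks
  have hL3 : (L : ℝ) ≤ 3 * (Fintype.card H : ℝ) ^ (1 - δ) := hblocks H hexp L A B C hS hAne hBne hCne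
  -- (ii) |H| ≤ L N₀³
  have hH3 : (Fintype.card H : ℝ) ≤ L * (N₀ : ℝ) ^ (3 : ℝ) := by
    refine hH.trans (mul_le_mul_of_nonneg_left ?_ (Nat.cast_nonneg _))
    calc (N : ℝ) ^ (2 + η) ≤ (N : ℝ) ^ (3 : ℝ) :=
          Real.rpow_le_rpow_of_exponent_le hN1 (by linarith)
      _ ≤ (N₀ : ℝ) ^ (3 : ℝ) :=
          Real.rpow_le_rpow (by linarith) (by exact_mod_cast hNN) (by norm_num)
  -- (iii) |H| ≤ K
  have hHK : (Fintype.card H : ℝ) ≤ K := by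
    have hsplit : (Fintype.card H : ℝ) =
        (Fintype.card H : ℝ) ^ (1 - δ) * (Fintype.card H : ℝ) ^ δ := by
      rw [← Real.rpow_add hcard0]; simp
    have hpow : (Fintype.card H : ℝ) ^ δ ≤ 3 * (N₀ : ℝ) ^ (3 : ℝ) := by
      have h1 : (0 : ℝ) < (Fintype.card H : ℝ) ^ (1 - δ) := Real.rpow_pos_of_pos hcard0 _
      have h2 : (Fintype.card H : ℝ) ^ (1 - δ) * (Fintype.card H : ℝ) ^ δ ≤
          (Fintype.card H : ℝ) ^ (1 - δ) * (3 * (N₀ : ℝ) ^ (3 : ℝ)) := by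
        calc _ = (Fintype.card H : ℝ) := hsplit.symm
          _ ≤ L * (N₀ : ℝ) ^ (3 : ℝ) := hH3
          _ ≤ 3 * (Fintype.card H : ℝ) ^ (1 - δ) * (N₀ : ℝ) ^ (3 : ℝ) :=
              mul_le_mul_of_nonneg_right hL3 (by positivity)
          _ = _ := by ring
      exact le_of_mul_le_mul_left h2 h1
    have h3 : (Fintype.card H : ℝ) = ((Fintype.card H : ℝ) ^ δ) ^ (1 / δ) := by
      rw [← Real.rpow_mul hcard0.le, mul_one_div_cancel hδ.ne', Real.rpow_one]
    rw [h3, hK]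
    exact Real.rpow_le_rpow (by positivity) hpow (by positivity)
  -- (iv) L ≤ K
  have hLK : (L : ℝ) ≤ K := by
    have key := two_leg_bound hS (fun i => (hc i).1) (fun i => (hc i).2.1) (fun i => (hc i).2.2)
      (by omega) ⟨0, hL⟩
    have : L ≤ Fintype.card H := by
      have hNN1 : 1 ≤ N * N := Nat.one_le_iff_ne_zero.2 (by positivity)
      nlinarith
    exact le_trans (by exact_mod_cast this) hHK
  -- (v) N^η ≥ 1 + 1/K
  have hforced := blocks_forced hS (fun i => (hc i).1) (fun i => (hc i).2.1) (fun i => (hc i).2.2)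
    (by omega) (by omega) hH
  have hLpos : (0 : ℝ) < L := by exact_mod_cast hL
  have hNη : ε ≤ (N : ℝ) ^ η := by
    have hM1 : (1 : ℝ) ≤ (M : ℝ) - 1 := by
      have : (2 : ℝ) ≤ M := by exact_mod_cast hM2
      linarith
    have h1 : 1 ≤ (L : ℝ) * ((N : ℝ) ^ η - 1) := hM1.trans hforced
    have h2 : 1 / K ≤ (N : ℝ) ^ η - 1 := by
      rw [div_le_iff₀ hK0]
      calc (1 : ℝ) ≤ (L : ℝ) * ((N : ℝ) ^ η - 1) := h1
        _ ≤ K * ((N : ℝ) ^ η - 1) := by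
            apply mul_le_mul_of_nonneg_right hLK
            by_contra hneg
            push Not at hneg
            nlinarith
        _ = ((N : ℝ) ^ η - 1) * K := by ring
    rw [hε]; linarith
  -- (vi) N^η ≤ N₀^{η₁} = ε^{1/2} < ε
  have hup : (N : ℝ) ^ η < ε := by
    calc (N : ℝ) ^ η ≤ (N₀ : ℝ) ^ η :=
          Real.rpow_le_rpow (by linarith) (by exact_mod_cast hNN) hη0.le
      _ ≤ (N₀ : ℝ) ^ η₁ := Real.rpow_le_rpow_of_exponent_le hN₀1.le hηle
      _ = ε ^ (1 / 2 : ℝ) := by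
          rw [hη₁, div_eq_mul_one_div, Real.rpow_mul hN₀0.le,
            Real.rpow_logb hN₀0 hN₀1.ne' (by linarith)]
      _ < ε ^ (1 : ℝ) := Real.rpow_lt_rpow_of_exponent_lt hε1 (by norm_num)
      _ = ε := Real.rpow_one ε
  linarith

end BlocksGrow

end Summit.MatrixMultiplication.MatrixMultiplication.Theorems.BoundedExponentThird.Negative
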